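import Summits.QuantumAdvantage.QuantumAdvantage.Theorems.CubicForrelationNearExactIsExactTenIsolation78Final
import Summits.QuantumAdvantage.QuantumAdvantage.Theorems.NearExactIsExact.Negative.MmPairFixedPoints
import Summits.QuantumAdvantage.QuantumAdvantage.Theorems.NearExactIsExact.Negative.ValueWitnesses

/-!
# Crux `CubicForrelation.NearExactIsExact` (stmt-QuantumAdvantage-14043): the `n = 10` isolation constant is
  EXACTLY `7/8` — one kernel-checked verdict, standard axioms only

Block-2b certificate seat `b2b-cforr-cert` (seat 3, 2026-08-19).  HONEST FRAMING: the value here is a DECIDABLE VERDICT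
about the finite slice `n = 10` of the crux `NearExactIsExact` — NOT summit progress.

What is proved at which `n` (tree, all kernel-checked): isolation of exactness for cubic pairs holds at `θ = 7/8` for
every even `n ≤ 10` (`nearExact78_le_six`, `isolation_eight`, and at `n = 10` the theorem `isolation_ten_78` /
`isolation_ten_78_digital` — two independent proofs, 2026-08-18/19), at `θ = 15/16` for `n = 12`
(`isolation_twelve_15_16`), `31/32` for `n = 14`, `63/64` for `n = 16`; on the other side `Φ = 7/8 < 1` is attained at
`n = 10`, `57/64` at `n = 12, 14`, and `15/16` at `n = 16` (`Negative/FifteenSixteenths.lean`) — so `7/8` is the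
sharp constant AT `n = 10` ONLY, and the crux's global constant (if it exists) is `≥ 15/16`.

THIS FILE closes the `n = 10` slice as a single two-sided statement:

* `theta_ten_isLeast`: `7/8` is the LEAST `θ` such that every cubic pair `f, g : 𝔽₂¹⁰ → 𝔽₂` with `Φ(f,g) > θ` is exact
  (`Φ = 1`) — i.e. `θ₁₀ = 7/8`;
* `forrelation_values_ten_isGreatest`: `7/8` is the LARGEST forrelation value `< 1` of a cubic pair on `10` bits.

The upper half is the landed `isolation_ten_78`.  The lower half needs `Φ(f_T, g_T) = 7/8` for the `T`-family pair
(`Negative.SmallCases.fT/gT`); the tree had this only via `native_decide` (`forrelation_fT_gT`, axiom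
`Lean.ofReduceBool`).  Here it is re-derived STRUCTURALLY (`tte_forrelation_eq_card` + `tte_card_defectFree`): both
functions are in two-sided Maiorana–McFarland sign form for the split `5 + 5` with the SAME quadratic map
`T(z) = (z₀, z₁, z₂, z₃ ⊕ z₀z₁, z₄ ⊕ z₂z₃)`, so by the landed fixed-point formula `forrelation_mmPair`
`Φ = #Fix(T ∘ T)/2⁵`; and `T(T(z)) = z ⊕ (0,0,0,0,z₀z₁z₂)`, so the fixed points are the `28` points off the flat
`{z₀ = z₁ = z₂ = 1}`.  Axioms of every declaration below: `propext`, `Classical.choice`, `Quot.sound` — no `native_decide`,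
no new definitions.

References: S. Aaronson, A. Ambainis, *Forrelation*, SIAM J. Comput. 47 (2018) §1.1.1 (the quantity `Φ`);
C. Carlet, *Boolean Functions for Cryptography and Coding Theory* (CUP 2021) §6.1 (Maiorana–McFarland duals);
R. L. McFarland, JCTA 15 (1973).  Everything here is proved from the tree.
-/

set_option linter.dupNamespace false -- D-0017: single-problem summit ⇒ `QuantumAdvantage.QuantumAdvantage` by design

noncomputable section

namespace Summit.QuantumAdvantage.QuantumAdvantage.Theorems.CubicForrelation.NearExactIsExact

open Finset
open Literature.Computability.QuantumComplexity
open Summit.QuantumAdvantage.QuantumAdvantage.Theorems.NearExactIsExact.Negative.SmallCases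
  (fT gT isDegLeFun_fT isDegLeFun_gT)
open Summit.QuantumAdvantage.QuantumAdvantage.Theorems.NearExactIsExact.Negative.MmPairFixedPoints
  (forrelation_mmPair)

/-! ### `Φ(f_T, g_T)` as a fixed-point count, without `native_decide` -/

/-- `(-1)^{u·v}` for a 5-term inner product is the twist. [folklore] -/
theorem tte_signOf_dot5 (u v : Fin 5 → Bool) :
    signOf ((u 0 && v 0) ^^ (u 1 && v 1) ^^ (u 2 && v 2) ^^ (u 3 && v 3) ^^ (u 4 && v 4)) = twist u v := by
  simp only [signOf_xor, twist, Fin.prod_univ_five]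
  rfl

/-- **The `T`-family value, structurally.** With `T(z) = (z₀, z₁, z₂, z₃ ⊕ z₀z₁, z₄ ⊕ z₂z₃)`, `g_T(y′ ‖ y″)` has sign
`(-1)^{y′·T(y″)}` and `f_T(x′ ‖ x″)` has sign `(-1)^{x″·T(x′)}`, so the two-sided Maiorana–McFarland fixed-point formula
`forrelation_mmPair` gives `Φ(f_T, g_T) = #Fix(T ∘ T)/2⁵`, and `T(T(z)) = z ⊕ (0,0,0,0,z₀z₁z₂)`:
`Φ(f_T, g_T) = #{z ∈ 𝔽₂⁵ : z₀z₁z₂ = 0} / 2⁵`.  (The tree's `Negative.SmallCases.forrelation_fT_gT` evaluates the same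
quantity by `native_decide`; here the standard axioms suffice.) [this work] -/
theorem tte_forrelation_eq_card :
    forrelation fT gT = ((univ.filter fun z : Fin 5 → Bool => (z 0 && z 1 && z 2) = false).card : ℝ) / 2 ^ 5 := by
  refine (forrelation_mmPair (m := 5) fT gT
    (fun z => ![z 0, z 1, z 2, z 3 ^^ (z 0 && z 1), z 4 ^^ (z 2 && z 3)])
    (fun z => ![z 0, z 1, z 2, z 3 ^^ (z 0 && z 1), z 4 ^^ (z 2 && z 3)])
    (fun _ => false) (fun _ => false) (fun y₁ y₂ => ?_) (fun x₁ x₂ => ?_)).trans ?_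
  · -- sign form of `g_T`: `(-1)^{g_T(y′ ‖ y″)} = (-1)^{y′·T(y″)}`
    rw [← tte_signOf_dot5]
    simp [signOf, gT, Fin.append, Fin.addCases]
  · -- sign form of `f_T`: `(-1)^{f_T(x′ ‖ x″)} = (-1)^{x″·T(x′)}`
    rw [← tte_signOf_dot5]
    simp [signOf, fT, Fin.append, Fin.addCases]
  · -- every fixed point of `T ∘ T` counts `+1`; the fixed points are `{z₀z₁z₂ = 0}`
    simp only [signOf, Bool.false_eq_true, if_false, mul_one]
    rw [sum_boole, div_eq_inv_mul]
    -- both counts are closed terms over the 32 points of `𝔽₂⁵`; `congr` closes `#Fix(T ∘ T) = #{z₀z₁z₂ = 0}` by evaluation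
    congr 3

/-- The flat `{z₀ = z₁ = z₂ = 1}` of `𝔽₂⁵` has `4` points; its complement has `28` (32 cases). [folklore] -/
theorem tte_card_defectFree :
    (univ.filter fun z : Fin 5 → Bool => (z 0 && z 1 && z 2) = false).card = 28 := by
  decide

/-! ### The verdict: `θ₁₀ = 7/8` -/

/-- **`θ₁₀ = 7/8`.**  `7/8` is the least real `θ` such that every pair of cubic Boolean functions `f, g : 𝔽₂¹⁰ → 𝔽₂`
with `Φ(f,g) > θ` has `Φ(f,g) = 1`: isolation holds at `7/8` (`isolation_ten_78`) and fails at every `θ < 7/8`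
(the `T`-family pair has `Φ = 7/8 ≠ 1`).  The `n = 10` slice of the crux `NearExactIsExact`, settled exactly;
NOT summit progress (the crux asks for one `θ < 1` uniform in `n`, and `Φ = 15/16` occurs at `n = 16`). [this work] -/
theorem theta_ten_isLeast :
    IsLeast {θ : ℝ | ∀ f g : (Fin 10 → Bool) → Bool, IsDegLeFun 3 f → IsDegLeFun 3 g →
      θ < forrelation f g → forrelation f g = 1} (7 / 8) := by
  have hval : forrelation fT gT = 7 / 8 := by
    rw [tte_forrelation_eq_card, tte_card_defectFree]; norm_num
  refine ⟨fun f g hf hg h => isolation_ten_78 f g hf hg h, fun θ hθ => ?_⟩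
  by_contra hlt
  have h1 := hθ fT gT isDegLeFun_fT isDegLeFun_gT (by rw [hval]; linarith)
  rw [hval] at h1
  norm_num at h1

/-- **The largest non-exact value at `n = 10` is `7/8`.**  Among all pairs of cubic Boolean functions on `10` bits
with `Φ(f,g) < 1`, the maximum of `Φ` is `7/8` (attained by the `T`-family pair; nothing lies in `(7/8, 1)` by
`isolation_ten_78`). [this work] -/
theorem forrelation_values_ten_isGreatest :
    IsGreatest {φ : ℝ | ∃ f g : (Fin 10 → Bool) → Bool, IsDegLeFun 3 f ∧ IsDegLeFun 3 g ∧
      forrelation f g = φ ∧ φ < 1} (7 / 8) := by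
  have hval : forrelation fT gT = 7 / 8 := by
    rw [tte_forrelation_eq_card, tte_card_defectFree]; norm_num
  refine ⟨⟨fT, gT, isDegLeFun_fT, isDegLeFun_gT, hval, by norm_num⟩, ?_⟩
  rintro φ ⟨f, g, hf, hg, rfl, hlt⟩
  by_contra h
  exact absurd (isolation_ten_78 f g hf hg (lt_of_not_ge h)) hlt.ne

end Summit.QuantumAdvantage.QuantumAdvantage.Theorems.CubicForrelation.NearExactIsExact
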